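import Literature.NumberTheory.Rogawski1990.ArchEPAssemblyMeasures            -- ★ (L2)-measures p852313 (this seat): `exists_radius_ballTransferFixedBody_of_prodConvention`
import Literature.NumberTheory.Rogawski1990.ArchEPAssemblyBallTransfer        -- ★ (G1) «glue-PC» p852328 (LH7-p04 (g9)): `exists_radius_ballTransferFixedBody_prodConvention_of_coupling` (the COMBINATOR; the three dock letters)
import Literature.NumberTheory.Rogawski1990.ArchEPAssemblyBallIdentityCoupling -- ★ (BD) p852356 (LH3-p03 (g8)): `ballIdentity_of_coupling` (= (G1)'s `hBI` letter; over ★ (BI) ED.2 p852352 + ★ (T1) p852310)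
import Literature.NumberTheory.Rogawski1990.ArchEPAssemblyBallSelection       -- ★ (Sel) p852327 (F0P3a-p08 (g27)): `exists_ballSelection_esymm3` (= (G1)'s `hSel` by bare name)
import Literature.NumberTheory.Rogawski1990.ArchEPAssemblyCoupling            -- ★ (CP) p852332 (LH7-p01 (g8)): `exists_coupling` (= (G1)'s `hCoup` letter, `∃ ε > 0` re-paired as `∃ εc, 0 < εc ∧`)
import Literature.NumberTheory.Automorphic.ArchStableClassRegularTorus        -- ★ `im_embedding_diagonal_eq_zero` (a `conj`-fixed diagonal frame is real at every complex place)
import Literature.NumberTheory.Rogawski1990.ArchEPAssembly                    -- ★ (L3) ED. 2 p852308: `mem_filter_not_isIndefiniteAt_iff`, the `hEP`∕`hBT` letters; brings `EPGeneratorAt`, `IsIndefiniteAt`, `slotSign`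
import Literature.NumberTheory.Automorphic.ArchInnerTwistPlaceTransportOrb     -- ★ (IT) PART 2 p852102: `isHaarMeasure_map_innerTwist`, `isMulRightInvariant_map_innerTwist`; brings PART 1 `exists_continuousMulEquiv_archLocal_innerTwist`
import Literature.NumberTheory.Automorphic.UnitaryGroupArchUnimodular          -- ★ U2: `modularCharacterFun_archLocal_eq_one` (the local unitary groups are unimodular)
import Literature.NumberTheory.Automorphic.GLnAdelicIntegrationFactsProofs    -- ★ `isMulRightInvariant_of_modularCharacterFun_eq_one`
import Literature.NumberTheory.Automorphic.ArchCongruenceOrbitalTransport      -- ★ `quasiSplitWeights_ne_zero`, `transpose_map_cmConjRingHom_diagonal_quasiSplitWeights`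
import Literature.NumberTheory.Rogawski1990.ArchInnerTwistChartDictionary       -- ★ `mem_splitChartPlaces_quasiSplitWeights` (every complex place is a split-chart place of `β₀`)
import HarnessLib

/-!
# EP ASSEMBLY, (L2) GLUE HEAD (G2): `ballTransfer_fixed` — the `hBT` letter of ★ (L3) ED. 2 from the product-convention ball transfer (G1)

Topic `NumberTheory/Rogawski1990`; namespace `Literature.NumberTheory.Rogawski1990`.  THEOREMS ONLY (no `def`, no instance, no notation, no axiom, no named fact, no `sorry`).
Cell `pub/hodgecm-mathlib`, crux H413 (`stmt-HodgeConjecture-24833`), line LH2 (closer stub `stub_N8`, organ (Sh)′), N8-INNER ROAD B «EP road» (dealer LH2-plan (g1)), brick (12′)∕E3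
«EP ASSEMBLY = H-S4′», E3a (L2) glue, piece **(G2)** of the pen's carving 2026-09-02 ≈17:58Z (pen LH3-p04 (g8); (G1) «glue-PC» LH7-p04 (g9), (BI) LH3-p03 (g8), (CP) LH7-p01 (g8)).

THE POINT.  ★ (L3) ED. 2 `stableSurjG_quasiSplit_of_ballTransferFixed` carries ONE provisional binder `hBT`: «the generic one-place EP generators `hEP` yield, for every
`a′ ∈ C_c^∞(U(diag α)_∞)`, radii `ε` and the ball-by-ball transfer at the head's FREE Haar pair `(μ′, μ)`».  (G1) proves the ball-by-ball transfer in the PRODUCT CONVENTION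
`(e⁻¹_* ⊗_w ν′_w, e⁻¹_* ⊗_w νβ_w)` from DATA the pen supplies: Borel structures at every place, a right-invariant Haar family `ν′_w` on the `U(α)_w`, the place isomorphisms
`ι_w : U(α)_w ≃ₜ* U(β₀)_w` at the `α`-INDEFINITE places carrying chart to chart (★ (IT)-1 `exists_continuousMulEquiv_archLocal_innerTwist`), the `β₀`-side family
`νβ_w := (ι_w)_* ν′_w` there and Haar on the `α`-definite block `D` (its Haar ∕ right-invariance facts as an `And`-package — two-frame hygiene, LH7-p01 (g8) 17:53:43Z), and the
EP generators `hEP|_D` at `(β₀, v, νβ_v)`, `v ∈ D`, read off the generic `hEP`.  This file BUILDS that data (`haar` + unimodularity ★ `modularCharacterFun_archLocal_eq_one` for right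
invariance; ★ `isHaarMeasure_map_innerTwist` ∕ ★ `isMulRightInvariant_map_innerTwist` for the push-forwards) and reads (G1)'s product-convention conclusion at `(μ′, μ)` through
★ (L2)-measures `exists_radius_ballTransferFixedBody_of_prodConvention` — so that `ballTransfer_fixed L α μ′ μ hα hherm hG1` has the TYPE of `hBT` token for token and (G3) is
`stableSurjG_quasiSplit_of_ballTransferFixed L α μ′ μ hα hherm hanis hEP (ballTransfer_fixed L α μ′ μ hα hherm hG1)`.  Until (G1) is ★ its head rides here as the binder `hG1`
(LHref-N rule); the day it lands the binder is discharged by name in a one-line ED. 2.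
HONEST LABEL: (Sh)′ ∕ row `stub_N8` stay PRINT-labelled until E3 and its binders are ★ and the leaf v10 is written; HC_CM is proved only modulo the 7 printed citations (2 remaining:
hLiu418 = stmt-HodgeConjecture-24832, h413 = stmt-HodgeConjecture-24833) until rung 0 closes; count-neutral plumbing.

## References
* [Rogawski1990] J. D. Rogawski, *Automorphic Representations of Unitary Groups in Three Variables*, Ann. of Math. Stud. 123 (1990), §1.7 p. 6, §14.2 (14.2.1) pp. 232–233.
* [Shelstad1979] D. Shelstad, *Characters and inner forms of a quasi-split group over ℝ*, Compositio Math. 39 (1979), §4 p. 24.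
* [Folland1995] G. B. Folland, *A Course in Abstract Harmonic Analysis* (1995), §2.2 Thm. 2.20, §2.6 (2.52).
* [Knapp2002] A. W. Knapp, *Lie Groups Beyond an Introduction*, 2nd ed. (2002), VIII §2 Cor. 8.31 (reductive groups are unimodular).
-/

set_option autoImplicit false

noncomputable section

open MeasureTheory MeasureTheory.Measure NumberField NumberField.InfinitePlace Complex Set Function Metric
open Literature.NumberTheory.Automorphic Literature.NumberTheory.Automorphic.UnitaryGroup Literature.NumberTheory.Automorphic.ArchCartan
open scoped Classical MatrixGroups Matrix NNReal ContDiff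
open scoped Matrix.Norms.Operator

namespace Literature.NumberTheory.Rogawski1990

section Glue

variable (L : Type) [Field L] [NumberField L] [IsCMField L] (α : Fin 3 → L)
  [MeasurableSpace ↥(arch (↥(maximalRealSubfield L)) L (IsCMField.complexConj L) 3 (Matrix.diagonal α))]
  [BorelSpace ↥(arch (↥(maximalRealSubfield L)) L (IsCMField.complexConj L) 3 (Matrix.diagonal α))]
  [MeasurableSpace ↥(arch (↥(maximalRealSubfield L)) L (IsCMField.complexConj L) 3 (Matrix.diagonal ![(2 : L)⁻¹, 1, -(2 : L)⁻¹]))]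
  [BorelSpace ↥(arch (↥(maximalRealSubfield L)) L (IsCMField.complexConj L) 3 (Matrix.diagonal ![(2 : L)⁻¹, 1, -(2 : L)⁻¹]))]
  (μ' : Measure ↥(arch (↥(maximalRealSubfield L)) L (IsCMField.complexConj L) 3 (Matrix.diagonal α)))
  (μ : Measure ↥(arch (↥(maximalRealSubfield L)) L (IsCMField.complexConj L) 3 (Matrix.diagonal ![(2 : L)⁻¹, 1, -(2 : L)⁻¹])))
  [μ'.IsHaarMeasure] [μ'.IsMulRightInvariant] [μ.IsHaarMeasure] [μ.IsMulRightInvariant]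

/-- **(G2) THE (L2) GLUE HEAD `ballTransfer_fixed` — the `hBT` letter of ★ (L3) ED. 2, from the (G1) combinator.**  For a nondegenerate real diagonal frame `α` and free
right-invariant Haar measures `μ′` on `U(diag α)_∞`, `μ` on `U(diag β₀)_∞` (`β₀ = (½, 1, −½)`), the generic one-place EP generators `hEP` yield, for every
`a′ ∈ C_c^∞(U(diag α)_∞)`, radii `ε > 0` and the ball-by-ball transfer `SS_{β₀}(f) = (∏_{w∈D} 3⁻¹) · SS_α((Π_v F v ∘ cl_v) · a′)` at `(μ′, μ)` (`D` the `α`-definite places) —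
all three docks of ★ (G1) being ★: the coupling ★ (CP) `exists_coupling` (p852332), the readings dock ★ (BD) `ballIdentity_of_coupling` (p852356, over ★ (BI) + ★ (T1)) and
the ball selection ★ `exists_ballSelection_esymm3` (p852327).  This file BUILDS the data — Borel structures at every place, `ν′_w := haar` (right invariant by unimodularity
★ `modularCharacterFun_archLocal_eq_one`), the place isomorphisms `ι_{w′}` at the `α`-indefinite places (★ (IT)-1 `exists_continuousMulEquiv_archLocal_innerTwist`; `w ∉ D ↔ w`
split-chart for `α`, ★ `mem_filter_not_isIndefiniteAt_iff`; every place split-chart for `β₀`, ★ `mem_splitChartPlaces_quasiSplitWeights`), `νβ_{w′} := (ι_{w′})_* haar` there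
(★ `isHaarMeasure_map_innerTwist`, ★ `isMulRightInvariant_map_innerTwist`) and `haar` on `D`, the generators `hEP|_D` read off `hEP` — feeds (G1)
`exists_radius_ballTransferFixedBody_prodConvention_of_coupling` and reads its product-convention conclusion at `(μ′, μ)` through ★ (L2)-measures
`exists_radius_ballTransferFixedBody_of_prodConvention` (instance families passed explicitly — two-frame hygiene).  The TYPE of `ballTransfer_fixed L α μ′ μ hα hherm` is the `hBT` letter
of ★ `stableSurjG_quasiSplit_of_ballTransferFixed` token for token: (G3) = `stableSurjG_quasiSplit_of_ballTransferFixed L α μ′ μ hα hherm hanis hEP (ballTransfer_fixed L α μ′ μ hα hherm)`.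
[cite: Rogawski1990, §14.2 (14.2.1) p. 232; §1.7 p. 6] [cite: Shelstad1979, §4 p. 24] [cite: Folland1995, §2.2 Thm. 2.20; §2.6 (2.52)] [cite: Knapp2002, VIII §2 Cor. 8.31] -/
theorem ballTransfer_fixed (hα : ∀ i, α i ≠ 0) (hherm : ∀ i, (IsCMField.complexConj L (α i) : L) = α i)
    (hEP : ∀ (w : {w : InfinitePlace L // IsComplex w})
      [MeasurableSpace ↥(archLocal L 3 (Matrix.diagonal ![(2 : L)⁻¹, 1, -(2 : L)⁻¹]) w)] [BorelSpace ↥(archLocal L 3 (Matrix.diagonal ![(2 : L)⁻¹, 1, -(2 : L)⁻¹]) w)]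
      (νw : Measure ↥(archLocal L 3 (Matrix.diagonal ![(2 : L)⁻¹, 1, -(2 : L)⁻¹]) w)) [νw.IsHaarMeasure] [νw.IsMulRightInvariant]
      (l : Fin 3 → ℂ), (∀ i, ‖l i‖ = 1) → EPGeneratorAt L ![(2 : L)⁻¹, 1, -(2 : L)⁻¹] w νw (esymm3 l)) :
    ∀ a' : ↥(arch (↥(maximalRealSubfield L)) L (IsCMField.complexConj L) 3 (Matrix.diagonal α)) → ℂ, ArchSmooth L 3 (Matrix.diagonal α) a' →
      ∃ ε : {w : InfinitePlace L // IsComplex w} → ℂ × ℂ × ℂ → ℝ, (∀ w b, 0 < ε w b) ∧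
        ∀ (ctr : ↥(Finset.univ.filter (fun w : {w : InfinitePlace L // IsComplex w} => ¬ IsIndefiniteAt (slotSign L α) w)) → ℂ × ℂ × ℂ)
          (F : ↥(Finset.univ.filter (fun w : {w : InfinitePlace L // IsComplex w} => ¬ IsIndefiniteAt (slotSign L α) w)) → ℂ × ℂ × ℂ → ℝ),
          (∀ v, ctr v ∈ Set.range fun t : Fin 3 → ℝ => esymm3 fun i => Complex.exp ((t i : ℂ) * I)) → (∀ v, ContDiff ℝ ∞ (F v)) →
          (∀ v, tsupport (F v) ⊆ ball (ctr v) (ε v (ctr v))) →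
            ∃ f : ↥(arch (↥(maximalRealSubfield L)) L (IsCMField.complexConj L) 3 (Matrix.diagonal ![(2 : L)⁻¹, 1, -(2 : L)⁻¹])) → ℂ,
              ArchSmooth L 3 (Matrix.diagonal ![(2 : L)⁻¹, 1, -(2 : L)⁻¹]) f ∧
              ∀ (S : Finset {w : InfinitePlace L // IsComplex w}) (c : {w : InfinitePlace L // IsComplex w} → Fin 3 → ℝ), c ∈ RegG S →
                stableSumG (orbFamGExt L ![(2 : L)⁻¹, 1, -(2 : L)⁻¹] μ f) S c =
                  (∏ _w ∈ Finset.univ.filter (fun w : {w : InfinitePlace L // IsComplex w} => ¬ IsIndefiniteAt (slotSign L α) w), (3 : ℂ)⁻¹) *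
                    stableSumG (orbFamGExt L α μ' (fun k => ((∏ v, F v (bzClassG L α k v) : ℝ) : ℂ) * a' k)) S c := by
  intro a' ha'
  -- the `α`-definite places
  set D : Finset {w : InfinitePlace L // IsComplex w} := Finset.univ.filter (fun w : {w : InfinitePlace L // IsComplex w} => ¬ IsIndefiniteAt (slotSign L α) w) with hDdef
  have hD : ∀ w, w ∈ D ↔ w ∉ splitChartPlaces L α := mem_filter_not_isIndefiniteAt_iff L α hα hherm
  -- Borel structures, local compactness, second countability at every place, both frames
  letI mα : ∀ w : {w : InfinitePlace L // IsComplex w}, MeasurableSpace ↥(archLocal L 3 (Matrix.diagonal α) w) := fun _ => borel _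
  haveI bα : ∀ w : {w : InfinitePlace L // IsComplex w}, BorelSpace ↥(archLocal L 3 (Matrix.diagonal α) w) := fun _ => ⟨rfl⟩
  letI mβ : ∀ w : {w : InfinitePlace L // IsComplex w}, MeasurableSpace ↥(archLocal L 3 (Matrix.diagonal ![(2 : L)⁻¹, 1, -(2 : L)⁻¹]) w) := fun _ => borel _
  haveI bβ : ∀ w : {w : InfinitePlace L // IsComplex w}, BorelSpace ↥(archLocal L 3 (Matrix.diagonal ![(2 : L)⁻¹, 1, -(2 : L)⁻¹]) w) := fun _ => ⟨rfl⟩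
  haveI lcα : ∀ w : {w : InfinitePlace L // IsComplex w}, LocallyCompactSpace ↥(archLocal L 3 (Matrix.diagonal α) w) := fun w => locallyCompactSpace_archLocal_three L α w
  haveI scα : ∀ w : {w : InfinitePlace L // IsComplex w}, SecondCountableTopology ↥(archLocal L 3 (Matrix.diagonal α) w) := fun w => secondCountableTopology_archLocal_three L α w
  haveI lcβ : ∀ w : {w : InfinitePlace L // IsComplex w}, LocallyCompactSpace ↥(archLocal L 3 (Matrix.diagonal ![(2 : L)⁻¹, 1, -(2 : L)⁻¹]) w) :=
    fun w => locallyCompactSpace_archLocal_three L ![(2 : L)⁻¹, 1, -(2 : L)⁻¹] w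
  haveI scβ : ∀ w : {w : InfinitePlace L // IsComplex w}, SecondCountableTopology ↥(archLocal L 3 (Matrix.diagonal ![(2 : L)⁻¹, 1, -(2 : L)⁻¹]) w) :=
    fun w => secondCountableTopology_archLocal_three L ![(2 : L)⁻¹, 1, -(2 : L)⁻¹] w
  -- the hermitian / nondegeneracy guards of the two frames (unimodularity inputs)
  have hhermα : ((Matrix.diagonal α).map (cmConjRingHom L)).transpose = Matrix.diagonal α := by
    rw [Matrix.diagonal_map (map_zero _), Matrix.diagonal_transpose]
    congr 1
    funext i
    exact hherm i
  have hdetα : (Matrix.diagonal α).det ≠ 0 := by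
    rw [Matrix.det_diagonal]
    exact Finset.prod_ne_zero_iff.2 fun i _ => hα i
  have hhermβ := transpose_map_cmConjRingHom_diagonal_quasiSplitWeights L
  have hdetβ : (Matrix.diagonal ![(2 : L)⁻¹, 1, -(2 : L)⁻¹]).det ≠ 0 := by
    rw [Matrix.det_diagonal]
    exact Finset.prod_ne_zero_iff.2 fun i _ => quasiSplitWeights_ne_zero L i
  -- the `α`-side Haar family (right invariant: the local unitary groups are unimodular)
  set ν'w : ∀ w : {w : InfinitePlace L // IsComplex w}, Measure ↥(archLocal L 3 (Matrix.diagonal α) w) := fun _ => MeasureTheory.Measure.haar with hν'w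
  haveI hν'H : ∀ w, (ν'w w).IsHaarMeasure := fun w => by rw [hν'w]; infer_instance
  haveI hν'R : ∀ w, (ν'w w).IsMulRightInvariant := fun w =>
    Literature.NumberTheory.Automorphic.isMulRightInvariant_of_modularCharacterFun_eq_one (modularCharacterFun_archLocal_eq_one L (Matrix.diagonal α) hhermα hdetα w) _
  -- the place isomorphisms at the `α`-indefinite places (subtype-indexed family, (G1)'s `ι`), with their ambient conjugation matrices ((CP)'s `M`, `hM`)
  have hιex : ∀ w' : {w : {w : InfinitePlace L // IsComplex w} // w ∉ D},
      ∃ ι : ↥(archLocal L 3 (Matrix.diagonal α) w'.1) ≃ₜ* ↥(archLocal L 3 (Matrix.diagonal ![(2 : L)⁻¹, 1, -(2 : L)⁻¹]) w'.1),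
        (∀ (S' : Finset {w : InfinitePlace L // IsComplex w}) (cw : Fin 3 → ℝ), ι (gprimeBlockAt L α w'.1 S' cw) = gprimeBlockAt L ![(2 : L)⁻¹, 1, -(2 : L)⁻¹] w'.1 S' cw) ∧
        ∃ M : GL (Fin 3) ℂ, ∀ h : ↥(archLocal L 3 (Matrix.diagonal α) w'.1),
          ((ι h : ↥(archLocal L 3 (Matrix.diagonal ![(2 : L)⁻¹, 1, -(2 : L)⁻¹]) w'.1)) : GL (Fin 3) ℂ) = M * (h : GL (Fin 3) ℂ) * M⁻¹ := by
    intro w'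
    have hwα : (w'.1 : {w : InfinitePlace L // IsComplex w}) ∈ splitChartPlaces L α := by
      by_contra h
      exact w'.2 ((hD w'.1).2 h)
    exact exists_continuousMulEquiv_archLocal_innerTwist L α ![(2 : L)⁻¹, 1, -(2 : L)⁻¹] w'.1 hα (quasiSplitWeights_ne_zero L) hwα
      (mem_splitChartPlaces_quasiSplitWeights L w'.1)
  choose ι hι M hM using hιex
  -- the frame facts the coupling reads: reality of `α` at every complex place, `D` inside the `α`-definite places
  have hreal : ∀ (w : {w : InfinitePlace L // IsComplex w}) (i : Fin 3), (w.1.embedding (α i)).im = 0 := fun w i => im_embedding_diagonal_eq_zero L 3 α hherm w i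
  have hD' : ∀ w : {w : InfinitePlace L // IsComplex w}, w ∈ D → w ∉ splitChartPlaces L α := fun w hw => (hD w).1 hw
  -- the `β₀`-side family: push-forwards off `D`, Haar on `D`; its Haar facts as an `And`-package (two-frame hygiene)
  let νβw : ∀ w : {w : InfinitePlace L // IsComplex w}, Measure ↥(archLocal L 3 (Matrix.diagonal ![(2 : L)⁻¹, 1, -(2 : L)⁻¹]) w) :=
    fun w => if hw : w ∈ D then MeasureTheory.Measure.haar else (ν'w w).map (ι ⟨w, hw⟩)
  have hβm : ∀ w, (νβw w).IsHaarMeasure ∧ (νβw w).IsMulRightInvariant := by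
    intro w
    by_cases hw : w ∈ D
    · have h1 : νβw w = MeasureTheory.Measure.haar := dif_pos hw
      rw [h1]
      exact ⟨inferInstance, Literature.NumberTheory.Automorphic.isMulRightInvariant_of_modularCharacterFun_eq_one
        (modularCharacterFun_archLocal_eq_one L (Matrix.diagonal ![(2 : L)⁻¹, 1, -(2 : L)⁻¹]) hhermβ hdetβ w) _⟩
    · have h1 : νβw w = (ν'w w).map (ι ⟨w, hw⟩) := dif_neg hw
      rw [h1]
      exact ⟨isHaarMeasure_map_innerTwist L α ![(2 : L)⁻¹, 1, -(2 : L)⁻¹] w (ι ⟨w, hw⟩) (ν'w w),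
        isMulRightInvariant_map_innerTwist L α ![(2 : L)⁻¹, 1, -(2 : L)⁻¹] w (ι ⟨w, hw⟩) (ν'w w)⟩
  have hνβI : ∀ w' : {w : {w : InfinitePlace L // IsComplex w} // w ∉ D}, νβw w'.1 = (ν'w w'.1).map (ι w') := by
    rintro ⟨w, hw⟩
    exact dif_neg hw
  -- the EP generators on the definite block, read off the generic one-place letter at `(β₀, v, νβ_v)`
  have hEPD : ∀ (v : ↥D) (l : Fin 3 → ℂ), (∀ i, ‖l i‖ = 1) →
      @EPGeneratorAt L _ _ _ ![(2 : L)⁻¹, 1, -(2 : L)⁻¹] (v : {w : InfinitePlace L // IsComplex w}) _ _ (νβw v) (hβm v).1 (hβm v).2 (esymm3 l) :=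
    fun v l hl => @hEP (v : {w : InfinitePlace L // IsComplex w}) _ _ (νβw v) (hβm v).1 (hβm v).2 l hl
  -- the three docks at this data: ★ (CP) `exists_coupling`, ★ (BD) `ballIdentity_of_coupling` (inline below, so the `Fintype ↥D` instance unifies with (G1)'s), ★ `exists_ballSelection_esymm3`
  -- (instance families passed explicitly — never both frames' measure families as local instances)
  have hCP' : ∀ b : ↥D → ℂ × ℂ × ℂ, (∀ v, b v ∈ Set.range fun t : Fin 3 → ℝ => esymm3 fun i => Complex.exp ((t i : ℂ) * I)) →
      ∃ εc : ℝ, 0 < εc ∧ ∃ G : (↥D → ℂ × ℂ × ℂ) → (∀ w' : {w : {w : InfinitePlace L // IsComplex w} // w ∉ D}, ↥(archLocal L 3 (Matrix.diagonal ![(2 : L)⁻¹, 1, -(2 : L)⁻¹]) w'.1)) → ℂ,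
      (∃ Gamb : (↥D → ℂ × ℂ × ℂ) × ({w : {w : InfinitePlace L // IsComplex w} // w ∉ D} → Matrix (Fin 3) (Fin 3) ℂ) → ℂ,
      ContDiff ℝ ∞ Gamb ∧ (∃ KI : Set ({w : {w : InfinitePlace L // IsComplex w} // w ∉ D} → Matrix (Fin 3) (Fin 3) ℂ), IsCompact KI ∧ ∀ z, ∀ Z ∉ KI, Gamb (z, Z) = 0) ∧
      ∀ z yβ, G z yβ = Gamb (z, fun w' => ((yβ w' : GL (Fin 3) ℂ) : Matrix (Fin 3) (Fin 3) ℂ))) ∧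
      ∀ x : ↥D → Fin 3 → ℝ, (∀ v, dist (esymm3 fun i => Complex.exp ((x v i : ℂ) * I)) (b v) < εc) →
      ∀ y : (∀ w' : {w : {w : InfinitePlace L // IsComplex w} // w ∉ D}, ↥(archLocal L 3 (Matrix.diagonal α) w'.1)),
      G (fun v => esymm3 fun i => Complex.exp ((x v i : ℂ) * I)) (fun w' => ι w' (y w')) =
      ∫ g : (∀ v : ↥D, ↥(archLocal L 3 (Matrix.diagonal α) (v : {w : InfinitePlace L // IsComplex w}))),
      a' ((archPiEquivCM 3 L (Matrix.diagonal α)).symm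
      ((MeasurableEquiv.piEquivPiSubtypeProd (fun w : {w : InfinitePlace L // IsComplex w} => ↥(archLocal L 3 (Matrix.diagonal α) w)) (· ∈ D)).symm
      (fun v => g v * gprimeBlockAt L α v.1 ∅ (x v) * (g v)⁻¹, y)))
      ∂(Measure.pi fun v : ↥D => ν'w v) := by
    intro b hb
    obtain ⟨ε, hε, G, hc, hb'⟩ := exists_coupling L α ![(2 : L)⁻¹, 1, -(2 : L)⁻¹] (· ∈ D) ν'w hα hreal hD' ι M hM a' ha' b hb
    exact ⟨ε, hε, G, hc, hb'⟩
  -- (G1) at the product-convention pair, read at `(μ′, μ)` through ★ (L2)-measures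
  have hPC := @exists_radius_ballTransferFixedBody_prodConvention_of_coupling L _ _ _ α ![(2 : L)⁻¹, 1, -(2 : L)⁻¹] D mα bα mβ bβ _ _ _ _ ν'w hν'H hν'R νβw
    (fun w => (hβm w).1) (fun w => (hβm w).2) ι (quasiSplitWeights_ne_zero L) hEPD a' hCP'
    (@ballIdentity_of_coupling L _ _ _ α ![(2 : L)⁻¹, 1, -(2 : L)⁻¹] D mα bα lcα scα mβ bβ lcβ scβ _ _ _ _ _ ν'w (fun w => ⟨hν'H w, hν'R w⟩) νβw
      (fun w => (hβm w).1) (fun w => (hβm w).2) ι hι hνβI hD hα (quasiSplitWeights_ne_zero L) hherm (mem_splitChartPlaces_quasiSplitWeights L) a' ha')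
    exists_ballSelection_esymm3
  exact @exists_radius_ballTransferFixedBody_of_prodConvention L _ _ _ α ![(2 : L)⁻¹, 1, -(2 : L)⁻¹] mα bα mβ bβ _ _ _ _ ν'w hν'H hν'R νβw
    (fun w => (hβm w).1) (fun w => (hβm w).2) μ' _ _ μ _ _ D a' _ hPC

end Glue

end Literature.NumberTheory.Rogawski1990

end
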